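import Literature.Analysis.FluidPDE.TorusPalinstrophyLadder
import Mathlib.Analysis.MeanInequalities
import Mathlib.Analysis.SpecialFunctions.Pow.Real
import HarnessLib

/-!
# The closed `H²` rate law on `T³`: `½ d/dt‖Δu‖₂² ≤ c ν^{-1/3} ‖Δu‖₂^{10/3}`, explicit `c` — PROVED

Analysis/FluidPDE file. Robinson–Sadowski–Silva 2012, §IV: for `3/2 < s < 5/2` (and `1/2 < s < 3/2`)
every smooth (zero-mean periodic, or whole-space) solution of the Navier–Stokes equations with `ν = 1`
obeys `½ d/dt‖u‖²_{Ḣˢ} + ‖u‖²_{Ḣ^{s+1}} ≤ c_s‖u‖_{Ḣˢ}^{s+1/2}‖u‖_{Ḣ^{s+1}}^{5/2−s}`, hence by Young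
`d/dt‖u‖²_{Ḣˢ} ≤ c_s‖u‖_{Ḣˢ}^{2(2s+1)/(2s−1)}` — the scaling-sharp `Ḣˢ` rate law behind the blow-up
rate `‖u(T−t)‖_{Ḣˢ} ≥ c_s t^{−(2s−1)/4}`. This file proves the case `s = 2` on the unit torus `T³`
for classical solutions, with general `ν > 0` and the constants made explicit, in two forms, for
every one-sided derivative `R` of `s ↦ ½∫‖Δu(s)‖²` within `[a, b]` (`𝒫 := ∫‖Δu‖²`,
`D₃ := ‖∇Δu‖₂² = Torus.gradNormSq (Δu)`):

* pre-Young form `R ≤ −ν D₃ + (3√2/π) 𝒫^{5/4} D₃^{1/4}`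
  (`Torus.IsClassicalNSSolutionOn.halfLaplacianSqRate_le_rpow`) — the `N = 2` ladder rung
  `R ≤ −νD₃ + 3‖∇u‖_{∞,F} 𝒫` (tree, Doering–Gibbon (6.2.27)) combined with Agmon for the gradient
  `‖∇u‖²_{∞,F} ≤ (2/π²)√𝒫√D₃` (tree);
* closed form `R ≤ c_𝒫 ν^{−1/3} 𝒫^{5/3}`, `c_𝒫 = (3/4)(3√2/π)^{4/3}4^{−1/3} ≈ 0.7053`
  (`palinstrophyRateConst`, `Torus.IsClassicalNSSolutionOn.halfLaplacianSqRate_le_const_mul_rpow`) —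
  Young with exponents `4/3`, `4` against the dissipation, exactly as printed.

This is the `H²` analogue of the Lu–Doering enstrophy law `dℰ/dt ≤ 27/(8π⁴ν³)ℰ³`
(`LuDoering2008_enstrophyRate_le_holds`); like it, a small-data / sharp-constant yardstick only.

## Mathlib / tree search

Tree: `TorusPalinstrophyLadder` (rung + gradient Agmon + interpolation), `ExtremeGrowthBoundsProofs`
(the `H¹` analogue). Mathlib: `Real.young_inequality_of_nonneg`, `Real.rpow_*` algebra. No `H²` rate law
existed (searched `rpow (5/3`, `palinstrophy`, `laplacian.*10/3`).

## References

* J. C. Robinson, W. Sadowski, R. P. Silva, *Lower bounds on blow up solutions of the three-dimensional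
  Navier–Stokes equations in homogeneous Sobolev spaces*, J. Math. Phys. 53 (2012) 115618, §IV
  (the `Ḣˢ` energy inequality and `d/dt‖u‖²_{Ḣˢ} ≤ c_s‖u‖_{Ḣˢ}^{2(2s+1)/(2s−1)}`, p. 10), Lemma 3.1
  (3.6). [RobinsonSadowskiSilva2012]
* C. R. Doering, J. D. Gibbon, *Applied Analysis of the Navier–Stokes Equations*, CUP 1995, §6.2
  (6.2.27). [DoeringGibbon1995]
-/

noncomputable section

open MeasureTheory Set Real

namespace Literature.Analysis.FluidPDE

open Literature.Analysis.FunctionSpaces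

variable {d : Type*} [Fintype d] [DecidableEq d]

/-- The explicit constant `c_𝒫 := (3/4)·(3√2/π)^{4/3}·4^{−1/3} ≈ 0.7053` of the closed `H²` rate law
`½ d/dt‖Δu‖₂² ≤ c_𝒫 ν^{−1/3} ‖Δu‖₂^{10/3}` on the unit torus `T³` (Robinson–Sadowski–Silva 2012 §IV at
`s = 2` print an unspecified `c_s`; this value comes from `c₂ = 3` in the Doering–Gibbon rung, the
Agmon constant `2/π²`, and the sharp Young split). [cite: RobinsonSadowskiSilva2012, §IV (s = 2)] -/
def palinstrophyRateConst : ℝ :=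
  3 / 4 * (3 * Real.sqrt 2 / π) ^ (4 / 3 : ℝ) * (4 : ℝ) ^ (-(1 / 3 : ℝ))

omit [Fintype d] [DecidableEq d] in
/-- `c_𝒫 > 0`. [cite: RobinsonSadowskiSilva2012, §IV (s = 2)] -/
theorem palinstrophyRateConst_pos : 0 < palinstrophyRateConst := by
  unfold palinstrophyRateConst
  positivity

/-- **Pre-Young form of the `H²` rate law on `T³`** (Robinson–Sadowski–Silva 2012, §IV, the
`Ḣˢ` energy inequality `½ d/dt‖u‖²_s + ν‖u‖²_{s+1} ≤ c‖u‖_{F¹}‖u‖²_s ≤ c_s‖u‖_s^{s+1/2}‖u‖_{s+1}^{5/2−s}`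
at `s = 2`, constants explicit): along a classical solution of the unforced Navier–Stokes system on
`T^d × [a, b]`, `card d = 3`, `a < b`, every one-sided derivative `R` of `s ↦ ½∫‖Δu(s)‖²` within
`[a, b]` at `t ∈ [a, b]` satisfies
`R ≤ −ν‖∇Δu(t)‖₂² + (3√2/π) (∫‖Δu(t)‖²)^{5/4} (‖∇Δu(t)‖₂²)^{1/4}`
(the rung `R ≤ −νD₃ + 3‖∇u‖_{∞,F}𝒫` and Agmon `‖∇u‖²_{∞,F} ≤ (2/π²)√𝒫√D₃`).
[cite: RobinsonSadowskiSilva2012, §IV (s = 2), with Lemma 3.1 (3.6)] -/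
theorem _root_.Literature.Analysis.FunctionSpaces.Torus.IsClassicalNSSolutionOn.halfLaplacianSqRate_le_rpow
    (hd : Fintype.card d = 3) {ν a b : ℝ} (hab : a < b)
    {u : ℝ → UnitAddTorus d → EuclideanSpace ℝ d} {p : ℝ → UnitAddTorus d → ℝ}
    (hsol : Torus.IsClassicalNSSolutionOn (Icc a b) ν 0 u p) {t : ℝ} (ht : t ∈ Icc a b) {R : ℝ}
    (hR : HasDerivWithinAt (fun s => 2⁻¹ * ∫ x, ‖Torus.laplacian (u s) x‖ ^ 2) R (Icc a b) t) :
    R ≤ -ν * Torus.gradNormSq (Torus.laplacian (u t)) +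
      3 * Real.sqrt 2 / π * (∫ x, ‖Torus.laplacian (u t) x‖ ^ 2) ^ (5 / 4 : ℝ) *
        Torus.gradNormSq (Torus.laplacian (u t)) ^ (1 / 4 : ℝ) := by
  have hut : Torus.IsSmooth (u t) := hsol.smooth_velocity.isSmooth_slice ht
  obtain ⟨P, hP⟩ : ∃ P, P = ∫ x, ‖Torus.laplacian (u t) x‖ ^ 2 := ⟨_, rfl⟩
  obtain ⟨D, hD⟩ : ∃ D, D = Torus.gradNormSq (Torus.laplacian (u t)) := ⟨_, rfl⟩
  have hP0 : 0 ≤ P := by rw [hP]; exact integral_nonneg fun _ => sq_nonneg _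
  have hD0 : 0 ≤ D := by rw [hD]; exact Torus.gradNormSq_nonneg _
  -- the gradient bound `M² = (2/π²) √P √D`
  obtain ⟨M2, hM2⟩ : ∃ M2, M2 = 2 / π ^ 2 * Real.sqrt P * Real.sqrt D := ⟨_, rfl⟩
  have hM2_nonneg : 0 ≤ M2 := by rw [hM2]; positivity
  obtain ⟨M, hM⟩ : ∃ M, M = Real.sqrt M2 := ⟨_, rfl⟩
  have hM0 : 0 ≤ M := by rw [hM]; exact Real.sqrt_nonneg _
  have hMsq : M ^ 2 = M2 := by rw [hM]; exact Real.sq_sqrt hM2_nonneg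
  have hgrad : ∀ x, ∑ i, ‖Torus.partialDeriv i (u t) x‖ ^ 2 ≤ M ^ 2 := fun x => by
    rw [hMsq, hM2, hP, hD]
    exact Torus.sum_norm_sq_partialDeriv_le_agmon_explicit hd hut x
  -- the rung
  have hrung := hsol.halfLaplacianSqRate_le_of_gradient_bound hab ht hM0 hgrad hR
  rw [← hP, ← hD] at hrung ⊢
  -- `3 M P = (3√2/π) P^{5/4} D^{1/4}`
  have hMval : M = Real.sqrt 2 / π * P ^ (1 / 4 : ℝ) * D ^ (1 / 4 : ℝ) := by
    have hpi : 0 < π := Real.pi_pos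
    have hsP : Real.sqrt P = P ^ (1 / 2 : ℝ) := Real.sqrt_eq_rpow P
    have hsD : Real.sqrt D = D ^ (1 / 2 : ℝ) := Real.sqrt_eq_rpow D
    have hq : ∀ y : ℝ, 0 ≤ y → Real.sqrt (y ^ (1 / 2 : ℝ)) = y ^ (1 / 4 : ℝ) := fun y hy => by
      rw [Real.sqrt_eq_rpow, ← Real.rpow_mul hy]; norm_num
    have h2pi : Real.sqrt (2 / π ^ 2) = Real.sqrt 2 / π := by
      rw [Real.sqrt_div' _ (by positivity), Real.sqrt_sq hpi.le]
    rw [hM, hM2, hsP, hsD, Real.sqrt_mul (mul_nonneg (by positivity) (Real.rpow_nonneg hP0 _)),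
      Real.sqrt_mul (by positivity), h2pi, hq P hP0, hq D hD0]
  have h3MP : 3 * M * P = 3 * Real.sqrt 2 / π * P ^ (5 / 4 : ℝ) * D ^ (1 / 4 : ℝ) := by
    rw [hMval]
    have h54 : P ^ (5 / 4 : ℝ) = P ^ (1 / 4 : ℝ) * P := by
      rw [show (5 / 4 : ℝ) = 1 / 4 + 1 by norm_num, Real.rpow_add_one' hP0 (by norm_num)]
    rw [h54]; ring
  linarith

/-- **The closed `H²` rate law on `T³` with explicit constant** (Robinson–Sadowski–Silva 2012, §IV:
`d/dt‖u‖²_{Ḣˢ} ≤ c_s‖u‖_{Ḣˢ}^{2(2s+1)/(2s−1)}` for `3/2 < s < 5/2`, `ν = 1`; here `s = 2`, general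
`ν > 0`, `c` explicit): along a classical solution of the unforced Navier–Stokes system on
`T^d × [a, b]`, `card d = 3`, `ν > 0`, `a < b`, every one-sided derivative `R` of `s ↦ ½∫‖Δu(s)‖²`
within `[a, b]` at `t ∈ [a, b]` satisfies `R ≤ c_𝒫 ν^{−1/3} (∫‖Δu(t)‖²)^{5/3}`,
`c_𝒫 = (3/4)(3√2/π)^{4/3}4^{−1/3}` (`palinstrophyRateConst`) — Young's inequality with exponents
`4/3` and `4` applied to `(3√2/π)𝒫^{5/4}D₃^{1/4} = [(3√2/π)𝒫^{5/4}(4ν)^{−1/4}]·[(4νD₃)^{1/4}]` absorbs the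
dissipation exactly. [cite: RobinsonSadowskiSilva2012, §IV (s = 2)] -/
theorem _root_.Literature.Analysis.FunctionSpaces.Torus.IsClassicalNSSolutionOn.halfLaplacianSqRate_le_const_mul_rpow
    (hd : Fintype.card d = 3) {ν a b : ℝ} (hν : 0 < ν) (hab : a < b)
    {u : ℝ → UnitAddTorus d → EuclideanSpace ℝ d} {p : ℝ → UnitAddTorus d → ℝ}
    (hsol : Torus.IsClassicalNSSolutionOn (Icc a b) ν 0 u p) {t : ℝ} (ht : t ∈ Icc a b) {R : ℝ}
    (hR : HasDerivWithinAt (fun s => 2⁻¹ * ∫ x, ‖Torus.laplacian (u s) x‖ ^ 2) R (Icc a b) t) :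
    R ≤ palinstrophyRateConst * ν ^ (-(1 / 3 : ℝ)) *
      (∫ x, ‖Torus.laplacian (u t) x‖ ^ 2) ^ (5 / 3 : ℝ) := by
  have hpre := hsol.halfLaplacianSqRate_le_rpow hd hab ht hR
  obtain ⟨P, hP⟩ : ∃ P, P = ∫ x, ‖Torus.laplacian (u t) x‖ ^ 2 := ⟨_, rfl⟩
  obtain ⟨D, hD⟩ : ∃ D, D = Torus.gradNormSq (Torus.laplacian (u t)) := ⟨_, rfl⟩
  rw [← hP, ← hD] at hpre
  rw [← hP]
  have hP0 : 0 ≤ P := by rw [hP]; exact integral_nonneg fun _ => sq_nonneg _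
  have hD0 : 0 ≤ D := by rw [hD]; exact Torus.gradNormSq_nonneg _
  have h4ν : 0 < 4 * ν := by positivity
  -- Young with exponents `4/3` and `4`
  obtain ⟨A, hA⟩ : ∃ A : ℝ, A = 3 * Real.sqrt 2 / π := ⟨_, rfl⟩
  have hA0 : 0 ≤ A := by rw [hA]; positivity
  obtain ⟨X, hX⟩ : ∃ X : ℝ, X = A * P ^ (5 / 4 : ℝ) * (4 * ν) ^ (-(1 / 4 : ℝ)) := ⟨_, rfl⟩
  obtain ⟨Y, hY⟩ : ∃ Y : ℝ, Y = (4 * ν) ^ (1 / 4 : ℝ) * D ^ (1 / 4 : ℝ) := ⟨_, rfl⟩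
  have hX0 : 0 ≤ X := by rw [hX]; positivity
  have hY0 : 0 ≤ Y := by rw [hY]; positivity
  have hpq : (4 / 3 : ℝ).HolderConjugate 4 := Real.holderConjugate_iff.2 ⟨by norm_num, by norm_num⟩
  have hyoung := Real.young_inequality_of_nonneg hX0 hY0 hpq
  -- `X · Y = A P^{5/4} D^{1/4}`
  have hXY : X * Y = A * P ^ (5 / 4 : ℝ) * D ^ (1 / 4 : ℝ) := by
    have h1 : (4 * ν) ^ (-(1 / 4 : ℝ)) * (4 * ν) ^ (1 / 4 : ℝ) = 1 := by
      rw [← Real.rpow_add h4ν]; norm_num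
    calc X * Y = A * P ^ (5 / 4 : ℝ) * D ^ (1 / 4 : ℝ) *
          ((4 * ν) ^ (-(1 / 4 : ℝ)) * (4 * ν) ^ (1 / 4 : ℝ)) := by rw [hX, hY]; ring
      _ = A * P ^ (5 / 4 : ℝ) * D ^ (1 / 4 : ℝ) := by rw [h1, mul_one]
  -- `Y⁴ = 4 ν D`
  have hY4 : Y ^ (4 : ℝ) = 4 * ν * D := by
    rw [hY, Real.mul_rpow (Real.rpow_nonneg h4ν.le _) (Real.rpow_nonneg hD0 _),
      ← Real.rpow_mul h4ν.le, ← Real.rpow_mul hD0]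
    norm_num
  -- `X^{4/3} = A^{4/3} P^{5/3} 4^{-1/3} ν^{-1/3}`
  have hX43 : X ^ (4 / 3 : ℝ) =
      A ^ (4 / 3 : ℝ) * P ^ (5 / 3 : ℝ) * ((4 : ℝ) ^ (-(1 / 3 : ℝ)) * ν ^ (-(1 / 3 : ℝ))) := by
    rw [hX, Real.mul_rpow (mul_nonneg hA0 (Real.rpow_nonneg hP0 _)) (Real.rpow_nonneg h4ν.le _),
      Real.mul_rpow hA0 (Real.rpow_nonneg hP0 _), ← Real.rpow_mul hP0, ← Real.rpow_mul h4ν.le,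
      ← Real.mul_rpow (by norm_num : (0 : ℝ) ≤ 4) hν.le]
    norm_num
  -- assemble
  have hmain : A * P ^ (5 / 4 : ℝ) * D ^ (1 / 4 : ℝ) ≤
      ν * D + palinstrophyRateConst * ν ^ (-(1 / 3 : ℝ)) * P ^ (5 / 3 : ℝ) := by
    rw [← hXY]
    refine hyoung.trans (le_of_eq ?_)
    rw [hY4, hX43, palinstrophyRateConst, ← hA]
    ring
  rw [← hA] at hpre
  linarith

end Literature.Analysis.FluidPDE

end
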